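import Mathlib
import HarnessLib

/-!
# The twice-integrated test function of a second difference
(crux `EmbeddedDrudeMourre.DrudeDissolution`, item stmt-AtomisticToContinuum-12593; `--supports` file for the
registered sub-goal `exists_smoothed_secondDiff` of stub B1b″ `stub_excursionSecondDifference` of line
`kinetic-polymer-gas-on-the-time-axis`; closes nothing; lead c13 (process B), 2026-08-17)

WHAT. For a continuous test function `φ` and `δ ≥ 0` put `φ₁ = ∫_0^· φ`, `φ₂ = ∫_0^· φ₁` and
`Φ(E) = φ₂(E+δ) − 2φ₂(E) + φ₂(E−δ)`. Then `Φ' = Φ₁ := φ₁(·+δ) − 2φ₁ + φ₁(·−δ)`,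
`Φ₁' = Φ₂ := φ(·+δ) − 2φ + φ(·−δ)` (the second difference of `φ` itself), and `|Φ| ≤ δ²` when `|φ| ≤ 1`
(`Φ(E) = ∫_E^{E+δ} (φ₁(u) − φ₁(u−δ)) du` with `|φ₁(u) − φ₁(u−δ)| = |∫_{u−δ}^u φ| ≤ δ`). Packaged as
`exists_smoothed_secondDiff`.

WHY (role). This is the test-function side of the `O(δ²)` mechanism of stub B1b″: after two integrations
by parts along a direction transversal to the level sets of `Ω` (on `ℝ³`:
`EmbeddedDrudeMourreDrudeDissolutionSecondDifferenceDirectional`; on the period cell: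
`EmbeddedDrudeMourreDrudeDissolutionCellSecondDifference`) the second difference
`∫ G·(2φ(Ω) − φ(Ω+δ) − φ(Ω−δ))` becomes `−∫ (L†L†G)·Φ(Ω)`, bounded by `δ²∫|L†L†G|` — with a constant that sees
no derivative of `φ`.
-/

noncomputable section

open MeasureTheory Set Filter Function Topology
open scoped Topology Interval

namespace Summit.AtomisticToContinuum.FouriersLaw.Theorems.DrudeDissolution.KineticPolymerGasOnTheTimeAxis

/-! ### §1 The twice-integrated test function -/

/-- FTC: `E ↦ ∫_0^E φ` has derivative `φ E` for continuous `φ`. [folklore] -/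
theorem sd_hasDerivAt_primitive {φ : ℝ → ℝ} (hφ : Continuous φ) (E : ℝ) :
    HasDerivAt (fun E => ∫ u in (0:ℝ)..E, φ u) (φ E) E :=
  (hφ.integral_hasStrictDerivAt 0 E).hasDerivAt

/-- The primitive of a continuous function is continuous. [folklore] -/
theorem sd_continuous_primitive {φ : ℝ → ℝ} (hφ : Continuous φ) :
    Continuous (fun E => ∫ u in (0:ℝ)..E, φ u) :=
  continuous_iff_continuousAt.2 fun E => (sd_hasDerivAt_primitive hφ E).continuousAt

/-- `|φ₁(u) − φ₁(u − δ)| ≤ δ` for the primitive `φ₁` of a continuous `φ` with `|φ| ≤ 1`, `δ ≥ 0`.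
[folklore] -/
theorem sd_primitive_sub_le {φ : ℝ → ℝ} (hφ : Continuous φ) (hφ1 : ∀ x, |φ x| ≤ 1) {δ : ℝ}
    (hδ : 0 ≤ δ) (u : ℝ) :
    |(∫ w in (0:ℝ)..u, φ w) - ∫ w in (0:ℝ)..(u - δ), φ w| ≤ δ := by
  rw [intervalIntegral.integral_interval_sub_left (hφ.intervalIntegrable _ _)
    (hφ.intervalIntegrable _ _)]
  have h := intervalIntegral.norm_integral_le_of_norm_le_const (a := u - δ) (b := u) (C := 1)
    (f := φ) (fun w _ => by simpa using hφ1 w)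
  simpa [abs_of_nonneg hδ] using h

/-- **The smoothed second difference is `O(δ²)`.** With `φ₁ = ∫_0^· φ`, `φ₂ = ∫_0^· φ₁` and
`Φ(E) = φ₂(E+δ) − 2φ₂(E) + φ₂(E−δ)`: `|Φ(E)| ≤ δ²` when `|φ| ≤ 1`, `δ ≥ 0`. [folklore] -/
theorem sd_smoothed_abs_le {φ : ℝ → ℝ} (hφ : Continuous φ) (hφ1 : ∀ x, |φ x| ≤ 1) {δ : ℝ}
    (hδ : 0 ≤ δ) (E : ℝ) :
    |(∫ u in (0:ℝ)..(E + δ), ∫ w in (0:ℝ)..u, φ w) - 2 * (∫ u in (0:ℝ)..E, ∫ w in (0:ℝ)..u, φ w)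
      + ∫ u in (0:ℝ)..(E - δ), ∫ w in (0:ℝ)..u, φ w| ≤ δ ^ 2 := by
  set φ₁ : ℝ → ℝ := fun u => ∫ w in (0:ℝ)..u, φ w with hφ₁def
  have hφ₁ : Continuous φ₁ := sd_continuous_primitive hφ
  have hint : ∀ a b : ℝ, IntervalIntegrable φ₁ volume a b := fun a b => hφ₁.intervalIntegrable a b
  have hsh : Continuous fun u => φ₁ (u - δ) := hφ₁.comp (continuous_id.sub continuous_const)
  have h1 : (∫ u in (0:ℝ)..(E + δ), φ₁ u) - ∫ u in (0:ℝ)..E, φ₁ u = ∫ u in E..(E + δ), φ₁ u :=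
    intervalIntegral.integral_interval_sub_left (hint _ _) (hint _ _)
  have h2 : (∫ u in (0:ℝ)..E, φ₁ u) - ∫ u in (0:ℝ)..(E - δ), φ₁ u = ∫ u in (E - δ)..E, φ₁ u :=
    intervalIntegral.integral_interval_sub_left (hint _ _) (hint _ _)
  have h3 : ∫ u in (E - δ)..E, φ₁ u = ∫ u in E..(E + δ), φ₁ (u - δ) := by
    rw [intervalIntegral.integral_comp_sub_right (fun u => φ₁ u) δ]
    simp
  have h4 : (∫ u in (0:ℝ)..(E + δ), φ₁ u) - 2 * (∫ u in (0:ℝ)..E, φ₁ u) + ∫ u in (0:ℝ)..(E - δ), φ₁ u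
      = ∫ u in E..(E + δ), (φ₁ u - φ₁ (u - δ)) := by
    rw [intervalIntegral.integral_sub (hint _ _) (hsh.intervalIntegrable _ _), ← h3, ← h1, ← h2]
    ring
  rw [h4]
  have h5 : ∀ u ∈ Ι E (E + δ), ‖φ₁ u - φ₁ (u - δ)‖ ≤ δ := fun u _ => by
    rw [Real.norm_eq_abs]
    exact sd_primitive_sub_le hφ hφ1 hδ u
  have h6 := intervalIntegral.norm_integral_le_of_norm_le_const h5
  have hlen : |E + δ - E| = δ := by rw [add_sub_cancel_left, abs_of_nonneg hδ]
  rw [Real.norm_eq_abs, hlen] at h6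
  nlinarith [h6]

/-- **The twice-integrated test function (registered sub-goal `exists_smoothed_secondDiff` of stub
B1b″).** For continuous `φ` and `δ ≥ 0` there are `Φ, Φ₁, Φ₂ : ℝ → ℝ` with `Φ' = Φ₁`, `Φ₁' = Φ₂`
everywhere, `Φ₂` continuous and equal to the second difference `φ(·+δ) − 2φ + φ(·−δ)`, and `|Φ| ≤ δ²`
whenever `|φ| ≤ 1`. [folklore] -/
theorem exists_smoothed_secondDiff :
    ∀ (φ : ℝ → ℝ) (δ : ℝ), Continuous φ → 0 ≤ δ →
      ∃ Φ Φ₁ Φ₂ : ℝ → ℝ, (∀ E, HasDerivAt Φ (Φ₁ E) E) ∧ (∀ E, HasDerivAt Φ₁ (Φ₂ E) E) ∧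
        Continuous Φ₂ ∧ (∀ E, Φ₂ E = φ (E + δ) - 2 * φ E + φ (E - δ)) ∧
        ((∀ x, |φ x| ≤ 1) → ∀ E, |Φ E| ≤ δ ^ 2) := by
  intro φ δ hφ hδ
  set φ₁ : ℝ → ℝ := fun u => ∫ w in (0:ℝ)..u, φ w with hφ₁def
  set φ₂ : ℝ → ℝ := fun E => ∫ u in (0:ℝ)..E, φ₁ u with hφ₂def
  have hφ₁c : Continuous φ₁ := sd_continuous_primitive hφ
  have hφ₁d : ∀ E, HasDerivAt φ₁ (φ E) E := sd_hasDerivAt_primitive hφ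
  have hφ₂d : ∀ E, HasDerivAt φ₂ (φ₁ E) E := sd_hasDerivAt_primitive hφ₁c
  refine ⟨fun E => φ₂ (E + δ) - 2 * φ₂ E + φ₂ (E - δ), fun E => φ₁ (E + δ) - 2 * φ₁ E + φ₁ (E - δ),
    fun E => φ (E + δ) - 2 * φ E + φ (E - δ), fun E => ?_, fun E => ?_, by fun_prop, fun E => rfl,
    fun hφ1 E => sd_smoothed_abs_le hφ hφ1 hδ E⟩
  · have ha : HasDerivAt (fun E => φ₂ (E + δ)) (φ₁ (E + δ)) E :=
      HasDerivAt.comp_add_const E δ (hφ₂d (E + δ))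
    have hb : HasDerivAt (fun E => φ₂ (E - δ)) (φ₁ (E - δ)) E :=
      HasDerivAt.comp_sub_const E δ (hφ₂d (E - δ))
    exact (ha.sub ((hφ₂d E).const_mul 2)).add hb
  · have ha : HasDerivAt (fun E => φ₁ (E + δ)) (φ (E + δ)) E :=
      HasDerivAt.comp_add_const E δ (hφ₁d (E + δ))
    have hb : HasDerivAt (fun E => φ₁ (E - δ)) (φ (E - δ)) E :=
      HasDerivAt.comp_sub_const E δ (hφ₁d (E - δ))
    exact (ha.sub ((hφ₁d E).const_mul 2)).add hb

end Summit.AtomisticToContinuum.FouriersLaw.Theorems.DrudeDissolution.KineticPolymerGasOnTheTimeAxis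

end
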